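import Literature.AlgebraicGeometry.ShimuraVarieties.UnitaryAuxiliarySpecialPairRecipMatrix
import Literature.NumberTheory.ComplexMultiplication.ReflexNormArtinMap
import HarnessLib

/-!
# The reciprocity element of a CM special pair of the Siegel datum is a symplectic similitude
# (non-vacuity of the `r`-binder of `SiegelRationalModel.IsCanonical`; [Deligne 1971] 3.9/4.18, [Milne ISV] (60)–(62))

Topic `AlgebraicGeometry/ModuliOfAbelianVarieties`; namespace
`Literature.AlgebraicGeometry.ModuliOfAbelianVarieties.CMStructure`.  THEOREMS ONLY (no definition, no named fact,
no instance, no `sorry`; net Literature debt **0**).  Sequel of ★ (σ4)-D `SiegelCanonicalModel` (`CMStructure`,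
`cmRepMatrix`, `cmRecipMatrix`, `SiegelRationalModel.IsCanonical`) and of §1 of ★ `UnitaryAuxiliarySpecialPairRecipMatrix`
(`cmRepMatrix_eq_of_linearMap`: `cmRepMatrix` is basis-free).  Cell hodgecm-mathlib (D-0151), banked GENERIC leaf toward
fan-B row I-7 (#60) `SiegelS1` (director g6 RULING s86 (2)(b); census memo `CENSUS-60-SiegelS1.A-p05g7.md` §1 row C3:
the non-vacuity theorem that (σ4)-D's docstring defers — «that this matrix IS a symplectic similitude (multiplier
`N_{E/ℚ}(s)`) is a theorem for the non-vacuity leaf, not asserted here»).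

WHAT IS PROVED.  For a CM structure `c` of type `δ` on `(ℚ^{2g}, ψ_δ)` ([Deligne1971TravauxShimura] 4.18: an injective
`ψ_δ`-self-adjoint action `act : F = ∏ᵢ Kᵢ → End_ℚ(ℚ^{2g})` of a CM algebra with `[F : ℚ] = 2g`):
* §1 `t ↦ c.cmRepMatrix t` (the action of `F ⊗ 𝔸_{ℚ,f} = ∏ᵢ 𝔸_{Kᵢ,f}` on `𝔸_{ℚ,f}^{2g}`) is MULTIPLICATIVE and unital
  (`cmRepMatrix_mul`, `cmRepMatrix_one`) — it is the `𝔸_{ℚ,f}`-algebra homomorphism `𝔸_{ℚ,f} ⊗_ℚ F → M_{2g}(𝔸_{ℚ,f})`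
  obtained from `act` by base change (Mathlib `Algebra.TensorProduct.lift` / `piRight`), read through the tree's
  `𝔸_{ℚ,f} ⊗_ℚ Kᵢ = 𝔸_{Kᵢ,f}` (★ `ratFiniteAdeleTensorEquiv`); scalars act by scalars (`cmRepMatrix_baseChange_scalar`).
* §2 the `ψ_δ`-ADJOINTNESS of `act` extends `𝔸_{ℚ,f}`-linearly: `(cmRepMatrix t)ᵀ · E_δ = E_δ · cmRepMatrix t̄`, `t̄` the
  componentwise complex conjugation of `∏ᵢ 𝔸_{Kᵢ,f}` (★ `finiteAdeleComplexConj`) (`transpose_cmRepMatrix_mul_typeFormOver`).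
* §3 for the RECIPROCITY ELEMENT `r = c.cmRecipMatrix Φ E s = cmRepMatrix (N_{E,Φᵢ}(s))ᵢ` of the special pair over a number
  field `E ⊆ ℂ` containing every reflex field `E*(Φᵢ)`: `rᵀ · E_δ · r = Nm_{E/ℚ}(s) • E_δ`
  (`transpose_cmRecipMatrix_mul_typeFormOver_mul_cmRecipMatrix`), by Milne's identity
  `N_{E,Φ}(s) · ι N_{E,Φ}(s) = Nm_{E⊗R/R}(s)` at `R = 𝔸_{ℚ,f}` (★ `reflexNormPoints_mul_conjPoints`); `r` is invertible;
  hence THE HEAD `exists_gspFinAdelic_coe_eq_cmRecipMatrix`: there is `r ∈ GSp_δ(𝔸_{ℚ,f})` (★ `gspFinAdelic δ`) whose matrix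
  is `c.cmRecipMatrix Φ E s`, with multiplier `Nm_{E/ℚ}(s)` (as `IsMultiplier`; matrix-only corollary
  `exists_gspFinAdelic_coe_eq_cmRecipMatrix'`) — the `∀ r, (r : matrix) = c.cmRecipMatrix Φ E s → …` binder of
  ★ `SiegelRationalModel.IsCanonical` is inhabited at EVERY CM special pair of 4.18 ([Milne2005ShimuraVarieties] Def. 12.8
  (60)–(61): `r(T, μ)(s) ∈ T(𝔸_f) ⊂ G(𝔸_f)`).
DECLS: `exists_algHom_extending_actMatrix`, `cmRepMatrix_eq_algHom`, `cmRepMatrix_mul`, `cmRepMatrix_one`,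
`cmRepMatrix_baseChange_scalar` (§1); `transpose_actMatrix_mul_typeFormOver`, `transpose_algHom_mul_typeFormOver`,
`transpose_cmRepMatrix_mul_typeFormOver` (§2); `transpose_cmRecipMatrix_mul_typeFormOver_mul_cmRecipMatrix`,
`cmRecipMatrix_mul_cmRecipMatrix_inv`, `cmRecipMatrix_inv_mul_cmRecipMatrix`, `isUnit_norm_symm`,
`exists_gspFinAdelic_coe_eq_cmRecipMatrix`, `exists_gspFinAdelic_coe_eq_cmRecipMatrix'`, `cmRecipMatrix_one`,
`cmRecipMatrix_mul` (§3; the last two appended 2026-08-28 R60-1b: `s ↦ r(s)` is a monoid homomorphism).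
Nothing printed is asserted.  HC_CM is proved only modulo the 7 printed citations until rung 0 closes.

## References
* [Deligne1971TravauxShimura] P. Deligne, *Travaux de Shimura*, Sém. Bourbaki 389 (1971), 3.9 p. 140, 4.18 p. 150.
* [Milne2005ShimuraVarieties] J. S. Milne, *Introduction to Shimura varieties* (2005), §6 p. 67 (`GSp(ψ)`), Def. 12.8
  (60)–(62) p. 114, Ex. 12.4 (b) p. 112.
* [MilneCM2006] J. S. Milne, *Complex Multiplication* (2006), Ch. I §1 Rem. 1.24 (b) (10), Rem. 1.25.
* [CasselsFrohlichANT1967] Cassels–Fröhlich, Ch. II §14 Lemma (14.2) (`𝔸_{ℚ,f} ⊗_ℚ k ≅ 𝔸_{k,f}`).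
-/

set_option autoImplicit false

noncomputable section

open Matrix NumberField IsDedekindDomain
open scoped TensorProduct

namespace Literature.AlgebraicGeometry.ModuliOfAbelianVarieties

namespace CMStructure

open Literature.NumberTheory.ComplexMultiplication
  (traceField ratFiniteAdeleTensorEquiv reflexNormFiniteIdele reflexNormFiniteAdele reflexNormPoints conjPoints
    finiteAdeleComplexConj reflexNormPoints_mul_conjPoints conjPoints_tmul finiteAdeleComplexConj_apply
    reflexNormFiniteAdele_apply coe_reflexNormFiniteIdele)

variable {g : ℕ} {δ : Fin g → ℕ} {ι : Type} [Fintype ι] [DecidableEq ι] {K : ι → Type} [∀ i, Field (K i)]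
  [∀ i, NumberField (K i)] [∀ i, IsCMField (K i)] (c : CMStructure g δ ι K)

/-! ### §1. `cmRepMatrix` is the base change of `act`: multiplicative, unital, scalars to scalars -/

/-- **There is an `𝔸_{ℚ,f}`-ALGEBRA homomorphism `Θ : ∏ᵢ (𝔸_{ℚ,f} ⊗_ℚ Kᵢ) → M_{2g}(𝔸_{ℚ,f})` extending `act`**:
`Θ (a ⊗ xᵢ)ᵢ = a · actMatrix x` — namely `act` read in the standard basis (`LinearMap.toMatrixAlgEquiv'`), entries cast
(`AlgHom.mapMatrix`), base-changed (`Algebra.TensorProduct.lift` against the scalars `𝔸_{ℚ,f} → M_{2g}(𝔸_{ℚ,f})`, which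
commute with everything) and composed with `∏ᵢ (𝔸_{ℚ,f} ⊗ Kᵢ) ≅ 𝔸_{ℚ,f} ⊗ ∏ᵢ Kᵢ` (`Algebra.TensorProduct.piRight`).
[Deligne1971TravauxShimura] 3.9/4.18: the torus `Res F^×` of the special pair acting on `V ⊗ 𝔸_f`.
[cite: Deligne1971TravauxShimura, 3.9 p. 140 and 4.18 p. 150] -/
theorem exists_algHom_extending_actMatrix :
    ∃ Θ : (Π i, finAdeleQ ⊗[ℚ] K i) →ₐ[finAdeleQ] Matrix (Fin g ⊕ Fin g) (Fin g ⊕ Fin g) finAdeleQ,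
      ∀ (a : finAdeleQ) (x : Π i, K i),
        Θ (fun i => a ⊗ₜ[ℚ] x i) = a • (c.actMatrix x).map (algebraMap ℚ finAdeleQ) := by
  let actA : (Π i, K i) →ₐ[ℚ] Matrix (Fin g ⊕ Fin g) (Fin g ⊕ Fin g) finAdeleQ :=
    ((Algebra.ofId ℚ finAdeleQ).mapMatrix.comp
        (LinearMap.toMatrixAlgEquiv' (R := ℚ) (n := Fin g ⊕ Fin g)).toAlgHom).comp c.act
  have hactA : ∀ x, actA x = (c.actMatrix x).map (algebraMap ℚ finAdeleQ) := fun x => rfl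
  let ΘT : finAdeleQ ⊗[ℚ] (Π i, K i) →ₐ[finAdeleQ] Matrix (Fin g ⊕ Fin g) (Fin g ⊕ Fin g) finAdeleQ :=
    Algebra.TensorProduct.lift (Algebra.ofId finAdeleQ _) actA fun a _ => Algebra.commute_algebraMap_left a _
  have hΘT : ∀ (a : finAdeleQ) (x : Π i, K i),
      ΘT (a ⊗ₜ[ℚ] x) = a • (c.actMatrix x).map (algebraMap ℚ finAdeleQ) := fun a x => by
    rw [Algebra.TensorProduct.lift_tmul, hactA, Algebra.ofId_apply, Algebra.smul_def]
  refine ⟨ΘT.comp ((Algebra.TensorProduct.piRight ℚ finAdeleQ finAdeleQ K).symm :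
      (Π i, finAdeleQ ⊗[ℚ] K i) →ₐ[finAdeleQ] finAdeleQ ⊗[ℚ] (Π i, K i)), fun a x => ?_⟩
  rw [← Algebra.TensorProduct.piRight_tmul ℚ finAdeleQ finAdeleQ K a x]
  change ΘT ((Algebra.TensorProduct.piRight ℚ finAdeleQ finAdeleQ K).symm
    (Algebra.TensorProduct.piRight ℚ finAdeleQ finAdeleQ K (a ⊗ₜ[ℚ] x))) = _
  rw [AlgEquiv.symm_apply_apply, hΘT]

/-- **`cmRepMatrix` is the value at `(e_{Kᵢ}⁻¹ tᵢ)ᵢ` of ANY such algebra homomorphism `Θ`** (★ `cmRepMatrix_eq_of_linearMap`: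
the bases of (σ4)-D only name the element). [cite: Deligne1971TravauxShimura, 3.9 p. 140 and 4.18 p. 150] -/
theorem cmRepMatrix_eq_algHom
    (Θ : (Π i, finAdeleQ ⊗[ℚ] K i) →ₐ[finAdeleQ] Matrix (Fin g ⊕ Fin g) (Fin g ⊕ Fin g) finAdeleQ)
    (hΘ : ∀ (a : finAdeleQ) (x : Π i, K i), Θ (fun i => a ⊗ₜ[ℚ] x i) = a • (c.actMatrix x).map (algebraMap ℚ finAdeleQ))
    (t : Π i, FiniteAdeleRing (𝓞 (K i)) (K i)) :
    c.cmRepMatrix t = Θ (fun i => (ratFiniteAdeleTensorEquiv (K i)).symm (t i)) :=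
  c.cmRepMatrix_eq_of_linearMap Θ.toLinearMap (fun x => by rw [AlgHom.toLinearMap_apply, hΘ, one_smul]) t

/-- **`cmRepMatrix` is MULTIPLICATIVE**: `R(t t′) = R(t) R(t′)` — the action of `F ⊗ 𝔸_{ℚ,f} = ∏ᵢ 𝔸_{Kᵢ,f}` on
`𝔸_{ℚ,f}^{2g}` through `act` is a ring homomorphism ([Deligne1971TravauxShimura] 3.9: the torus `T(𝔸_f)` acting on
`V ⊗ 𝔸_f`). [cite: Deligne1971TravauxShimura, 3.9 p. 140 and 4.18 p. 150] [cite: Milne2005ShimuraVarieties, Def. 12.8 (60) p. 114] -/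
theorem cmRepMatrix_mul (t t' : Π i, FiniteAdeleRing (𝓞 (K i)) (K i)) :
    c.cmRepMatrix (t * t') = c.cmRepMatrix t * c.cmRepMatrix t' := by
  obtain ⟨Θ, hΘ⟩ := c.exists_algHom_extending_actMatrix
  rw [c.cmRepMatrix_eq_algHom Θ hΘ, c.cmRepMatrix_eq_algHom Θ hΘ, c.cmRepMatrix_eq_algHom Θ hΘ, ← map_mul]
  congr 1
  funext i
  rw [Pi.mul_apply, Pi.mul_apply, map_mul]

/-- **`cmRepMatrix 1 = 1`.** [cite: Deligne1971TravauxShimura, 3.9 p. 140 and 4.18 p. 150] -/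
theorem cmRepMatrix_one : c.cmRepMatrix 1 = 1 := by
  obtain ⟨Θ, hΘ⟩ := c.exists_algHom_extending_actMatrix
  rw [c.cmRepMatrix_eq_algHom Θ hΘ]
  have h : (fun i => (ratFiniteAdeleTensorEquiv (K i)).symm ((1 : Π i, FiniteAdeleRing (𝓞 (K i)) (K i)) i)) = 1 := by
    funext i
    rw [Pi.one_apply, map_one, Pi.one_apply]
  rw [h, map_one]

/-- **Scalars act by scalars**: for `a ∈ 𝔸_{ℚ,f}`, the element `(e_{Kᵢ}(a ⊗ 1))ᵢ` of `∏ᵢ 𝔸_{Kᵢ,f}` (the image of `a`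
under `𝔸_{ℚ,f} → F ⊗ 𝔸_{ℚ,f}`) acts on `𝔸_{ℚ,f}^{2g}` as `a • 1`. [cite: Deligne1971TravauxShimura, 3.9 p. 140]
[cite: CasselsFrohlichANT1967, Ch. II §14 Lemma (14.2)] -/
theorem cmRepMatrix_baseChange_scalar (a : finAdeleQ) :
    c.cmRepMatrix (fun i => ratFiniteAdeleTensorEquiv (K i) (a ⊗ₜ[ℚ] (1 : K i))) =
      a • (1 : Matrix (Fin g ⊕ Fin g) (Fin g ⊕ Fin g) finAdeleQ) := by
  obtain ⟨Θ, hΘ⟩ := c.exists_algHom_extending_actMatrix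
  rw [c.cmRepMatrix_eq_algHom Θ hΘ]
  have h : (fun i => (ratFiniteAdeleTensorEquiv (K i)).symm (ratFiniteAdeleTensorEquiv (K i) (a ⊗ₜ[ℚ] (1 : K i)))) =
      fun i => a ⊗ₜ[ℚ] (1 : Π i, K i) i := by
    funext i
    rw [RingEquiv.symm_apply_apply, Pi.one_apply]
  rw [h, hΘ, actMatrix_one, Matrix.map_one (algebraMap ℚ finAdeleQ) (map_zero _) (map_one _)]

/-! ### §2. `ψ_δ`-adjointness over `𝔸_{ℚ,f}`: `R(t)ᵀ E_δ = E_δ R(t̄)` -/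

omit [DecidableEq ι] in
/-- **The `adjoint` axiom in matrix form (over `ℚ`)**: `(actMatrix x)ᵀ · E_δ = E_δ · actMatrix x̄`
(`ψ_δ(x·v, w) = ψ_δ(v, x̄·w)` for all `v, w`, read through Mathlib `Matrix.toBilin'`).
[cite: Deligne1971TravauxShimura, 4.18 p. 150 («stable par l'involution `*` définie par `ψ`»)] -/
theorem transpose_actMatrix_mul_typeFormOver (x : Π i, K i) :
    (c.actMatrix x)ᵀ * typeFormOver δ ℚ =
      typeFormOver δ ℚ * c.actMatrix (fun i => IsCMField.complexConj (K i) (x i)) := by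
  apply Matrix.toBilin'.injective
  refine LinearMap.ext₂ fun v w => ?_
  rw [Matrix.toBilin'_apply', Matrix.toBilin'_apply', ← Matrix.mulVec_mulVec, ← Matrix.mulVec_mulVec,
    Matrix.dotProduct_mulVec v (c.actMatrix x)ᵀ, Matrix.vecMul_transpose]
  have h := c.adjoint x v w
  rwa [actMatrix, actMatrix, LinearMap.toMatrix'_mulVec, LinearMap.toMatrix'_mulVec]

/-- `Θ(z)ᵀ E_δ = E_δ Θ(z̄)` on `∏ᵢ (𝔸_{ℚ,f} ⊗ Kᵢ)` for any algebra homomorphism `Θ` extending `act` (induction on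
`z = piRight w`, `w ∈ 𝔸_{ℚ,f} ⊗ F`; the step behind `transpose_cmRepMatrix_mul_typeFormOver`).
[cite: Deligne1971TravauxShimura, 4.18 p. 150] -/
theorem transpose_algHom_mul_typeFormOver
    (Θ : (Π i, finAdeleQ ⊗[ℚ] K i) →ₐ[finAdeleQ] Matrix (Fin g ⊕ Fin g) (Fin g ⊕ Fin g) finAdeleQ)
    (hΘ : ∀ (a : finAdeleQ) (x : Π i, K i), Θ (fun i => a ⊗ₜ[ℚ] x i) = a • (c.actMatrix x).map (algebraMap ℚ finAdeleQ))
    (z : Π i, finAdeleQ ⊗[ℚ] K i) :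
    (Θ z)ᵀ * typeFormOver δ finAdeleQ = typeFormOver δ finAdeleQ * Θ (fun i => conjPoints (K i) finAdeleQ (z i)) := by
  obtain ⟨w, rfl⟩ := (Algebra.TensorProduct.piRight ℚ finAdeleQ finAdeleQ K).surjective z
  induction w using TensorProduct.induction_on with
  | zero =>
    have h0 : (fun i => conjPoints (K i) finAdeleQ
        ((Algebra.TensorProduct.piRight ℚ finAdeleQ finAdeleQ K) (0 : finAdeleQ ⊗[ℚ] (Π i, K i)) i)) = 0 := by
      funext i; simp only [map_zero, Pi.zero_apply]
    rw [h0, map_zero, map_zero, Matrix.transpose_zero, Matrix.zero_mul, Matrix.mul_zero]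
  | tmul a x =>
    have h1 : (fun i => conjPoints (K i) finAdeleQ
        ((Algebra.TensorProduct.piRight ℚ finAdeleQ finAdeleQ K) (a ⊗ₜ[ℚ] x) i)) =
        fun i => a ⊗ₜ[ℚ] (fun j => IsCMField.complexConj (K j) (x j)) i := by
      funext i; rw [Algebra.TensorProduct.piRight_tmul, conjPoints_tmul]
    rw [h1, hΘ, Algebra.TensorProduct.piRight_tmul, hΘ, Matrix.transpose_smul, Matrix.smul_mul,
      Matrix.mul_smul, ← Matrix.transpose_map, ← typeFormOver_map δ (algebraMap ℚ finAdeleQ), ← Matrix.map_mul,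
      ← Matrix.map_mul, transpose_actMatrix_mul_typeFormOver]
  | add w₁ w₂ h₁ h₂ =>
    have hadd : (fun i => conjPoints (K i) finAdeleQ
        ((Algebra.TensorProduct.piRight ℚ finAdeleQ finAdeleQ K) (w₁ + w₂) i)) =
        (fun i => conjPoints (K i) finAdeleQ ((Algebra.TensorProduct.piRight ℚ finAdeleQ finAdeleQ K) w₁ i)) +
        (fun i => conjPoints (K i) finAdeleQ ((Algebra.TensorProduct.piRight ℚ finAdeleQ finAdeleQ K) w₂ i)) := by
      funext i; rw [map_add, Pi.add_apply, map_add, Pi.add_apply]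
    rw [hadd, map_add, map_add, map_add, Matrix.transpose_add, Matrix.add_mul, Matrix.mul_add, h₁, h₂]

/-- **`ψ_δ`-ADJOINTNESS OVER `𝔸_{ℚ,f}`: `R(t)ᵀ · E_δ = E_δ · R(t̄)`** for every `t ∈ ∏ᵢ 𝔸_{Kᵢ,f}`, `t̄ᵢ = ` ★
`finiteAdeleComplexConj (K i) (t i)` — the `𝔸_{ℚ,f}`-linear extension of the `adjoint` axiom of the CM structure
(both sides are additive and `𝔸_{ℚ,f}`-homogeneous in `e⁻¹ t ∈ 𝔸_{ℚ,f} ⊗ F`; on pure tensors it is the `ℚ`-identity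
`transpose_actMatrix_mul_typeFormOver` with entries cast).  [Milne2005ShimuraVarieties] Def. 12.8 (60)–(61): the
reciprocity torus lies in `G = GSp(ψ)`. [cite: Deligne1971TravauxShimura, 3.9 p. 140 and 4.18 p. 150]
[cite: Milne2005ShimuraVarieties, §6 p. 67 and Def. 12.8 (60)–(61) p. 114] -/
theorem transpose_cmRepMatrix_mul_typeFormOver (t : Π i, FiniteAdeleRing (𝓞 (K i)) (K i)) :
    (c.cmRepMatrix t)ᵀ * typeFormOver δ finAdeleQ =
      typeFormOver δ finAdeleQ * c.cmRepMatrix (fun i => finiteAdeleComplexConj (K i) (t i)) := by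
  obtain ⟨Θ, hΘ⟩ := c.exists_algHom_extending_actMatrix
  rw [c.cmRepMatrix_eq_algHom Θ hΘ, c.cmRepMatrix_eq_algHom Θ hΘ]
  have hconj : (fun i => (ratFiniteAdeleTensorEquiv (K i)).symm (finiteAdeleComplexConj (K i) (t i))) =
      fun i => conjPoints (K i) finAdeleQ ((ratFiniteAdeleTensorEquiv (K i)).symm (t i)) := by
    funext i
    rw [finiteAdeleComplexConj_apply, RingEquiv.symm_apply_apply]
  rw [hconj]
  exact c.transpose_algHom_mul_typeFormOver Θ hΘ _

/-! ### §3. The reciprocity element `r = cmRecipMatrix c Φ E s` is a symplectic similitude with multiplier `Nm_{E/ℚ}(s)` -/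

section Recip

variable (Φ : ∀ i, Motives.CMType (K i)) (E : IntermediateField ℚ ℂ) [NumberField ↥E]

omit [Fintype ι] [DecidableEq ι] [∀ i, IsCMField (K i)] in
/-- The tuple of reflex norms read in `𝔸_{ℚ,f} ⊗ Kᵢ`: `e_{Kᵢ}⁻¹ (N_{E,Φᵢ}(s)) = N_{E,Φᵢ}(𝔸_{ℚ,f})(e_E⁻¹ s)`
(★ `reflexNormFiniteAdele_apply`). [cite: MilneCM2006, Ch. I §1 Rem. 1.25] -/
private theorem symm_reflexNormFiniteIdele (s : (FiniteAdeleRing (𝓞 ↥E) ↥E)ˣ) (i : ι) :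
    (ratFiniteAdeleTensorEquiv (K i)).symm
        ((reflexNormFiniteIdele (K i) (Φ i) E s : (FiniteAdeleRing (𝓞 (K i)) (K i))ˣ) :
          FiniteAdeleRing (𝓞 (K i)) (K i)) =
      reflexNormPoints (K i) (Φ i) E finAdeleQ
        ((ratFiniteAdeleTensorEquiv ↥E).symm (s : FiniteAdeleRing (𝓞 ↥E) ↥E)) := by
  rw [coe_reflexNormFiniteIdele, reflexNormFiniteAdele_apply, RingEquiv.symm_apply_apply]

/-- **`rᵀ · E_δ · r = Nm_{E/ℚ}(s) • E_δ` for the reciprocity element `r = c.cmRecipMatrix Φ E s`** of a CM special pair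
over a number field `E ⊆ ℂ` containing every reflex field `E*(Φᵢ)`: by §2, `rᵀ E_δ r = E_δ · R(N(s)‾ · N(s))`, and
`N_{E,Φᵢ}(s) · ι N_{E,Φᵢ}(s) = Nm_{E⊗R/R}(s)` in `𝔸_{ℚ,f} ⊗ Kᵢ` for every `i` ([MilneCM2006] I (10) at `R = 𝔸_{ℚ,f}`,
★ `reflexNormPoints_mul_conjPoints`), a SCALAR, which acts by `Nm(s) • 1` (§1).  Here `Nm_{E/ℚ}(s)` is
`Algebra.norm 𝔸_{ℚ,f} (e_E⁻¹ s)`, the norm of `𝔸_{ℚ,f} ⊗_ℚ E` over `𝔸_{ℚ,f}`.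
[cite: MilneCM2006, Ch. I §1 Rem. 1.24 (b) (10) and Rem. 1.25] [cite: Milne2005ShimuraVarieties, Def. 12.8 (60)–(61) p. 114] -/
theorem transpose_cmRecipMatrix_mul_typeFormOver_mul_cmRecipMatrix (hE : ∀ i, traceField (Φ i) ≤ E)
    (s : (FiniteAdeleRing (𝓞 ↥E) ↥E)ˣ) :
    (c.cmRecipMatrix Φ E s)ᵀ * typeFormOver δ finAdeleQ * c.cmRecipMatrix Φ E s =
      Algebra.norm finAdeleQ ((ratFiniteAdeleTensorEquiv ↥E).symm (s : FiniteAdeleRing (𝓞 ↥E) ↥E)) •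
        typeFormOver δ finAdeleQ := by
  unfold cmRecipMatrix
  rw [transpose_cmRepMatrix_mul_typeFormOver, Matrix.mul_assoc, ← cmRepMatrix_mul]
  have h : ((fun i => finiteAdeleComplexConj (K i)
        ((reflexNormFiniteIdele (K i) (Φ i) E s : (FiniteAdeleRing (𝓞 (K i)) (K i))ˣ) :
          FiniteAdeleRing (𝓞 (K i)) (K i))) *
        fun i => ((reflexNormFiniteIdele (K i) (Φ i) E s : (FiniteAdeleRing (𝓞 (K i)) (K i))ˣ) :
          FiniteAdeleRing (𝓞 (K i)) (K i))) =
      fun i => ratFiniteAdeleTensorEquiv (K i)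
        (Algebra.norm finAdeleQ ((ratFiniteAdeleTensorEquiv ↥E).symm (s : FiniteAdeleRing (𝓞 ↥E) ↥E)) ⊗ₜ[ℚ]
          (1 : K i)) := by
    funext i
    rw [Pi.mul_apply]
    apply (ratFiniteAdeleTensorEquiv (K i)).symm.injective
    rw [map_mul, RingEquiv.symm_apply_apply, finiteAdeleComplexConj_apply, RingEquiv.symm_apply_apply,
      symm_reflexNormFiniteIdele, mul_comm, reflexNormPoints_mul_conjPoints (K i) finAdeleQ (Φ i) E (hE i)]
  rw [h, cmRepMatrix_baseChange_scalar, Matrix.mul_smul, Matrix.mul_one]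

/-- **The reciprocity element is invertible**: `R(N(s)) · R(N(s⁻¹)) = 1 = R(N(s⁻¹)) · R(N(s))` (§1 multiplicativity;
`N` is a homomorphism into the finite idèles). [cite: Milne2005ShimuraVarieties, Def. 12.8 (60) p. 114] -/
theorem cmRecipMatrix_mul_cmRecipMatrix_inv (s : (FiniteAdeleRing (𝓞 ↥E) ↥E)ˣ) :
    c.cmRecipMatrix Φ E s * c.cmRecipMatrix Φ E s⁻¹ = 1 := by
  unfold cmRecipMatrix
  rw [← cmRepMatrix_mul]
  have h : ((fun i => ((reflexNormFiniteIdele (K i) (Φ i) E s : (FiniteAdeleRing (𝓞 (K i)) (K i))ˣ) :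
        FiniteAdeleRing (𝓞 (K i)) (K i))) *
        fun i => ((reflexNormFiniteIdele (K i) (Φ i) E s⁻¹ : (FiniteAdeleRing (𝓞 (K i)) (K i))ˣ) :
          FiniteAdeleRing (𝓞 (K i)) (K i))) = 1 := by
    funext i
    rw [Pi.mul_apply, Pi.one_apply, ← Units.val_mul, ← map_mul, mul_inv_cancel, map_one, Units.val_one]
  rw [h, cmRepMatrix_one]

/-- `R(N(s⁻¹)) · R(N(s)) = 1`. [cite: Milne2005ShimuraVarieties, Def. 12.8 (60) p. 114] -/
theorem cmRecipMatrix_inv_mul_cmRecipMatrix (s : (FiniteAdeleRing (𝓞 ↥E) ↥E)ˣ) :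
    c.cmRecipMatrix Φ E s⁻¹ * c.cmRecipMatrix Φ E s = 1 := by
  simpa only [inv_inv] using c.cmRecipMatrix_mul_cmRecipMatrix_inv Φ E s⁻¹

/-- `e_E⁻¹ s` is a unit of `𝔸_{ℚ,f} ⊗ E`, so its norm is a unit of `𝔸_{ℚ,f}`. [cite: MilneCM2006, Ch. I §1 Rem. 1.25] -/
theorem isUnit_norm_symm (s : (FiniteAdeleRing (𝓞 ↥E) ↥E)ˣ) :
    IsUnit (Algebra.norm finAdeleQ ((ratFiniteAdeleTensorEquiv ↥E).symm (s : FiniteAdeleRing (𝓞 ↥E) ↥E))) :=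
  ((Units.isUnit s).map (ratFiniteAdeleTensorEquiv ↥E).symm).map (Algebra.norm finAdeleQ)

/-- **HEAD — the reciprocity element is a symplectic similitude: `∃ r ∈ GSp_δ(𝔸_{ℚ,f})` with
`(r : matrix) = c.cmRecipMatrix Φ E s` and multiplier `Nm_{E/ℚ}(s)`** — the `∀ r, (r : matrix) = c.cmRecipMatrix Φ E s → …`
binder of ★ `SiegelRationalModel.IsCanonical` is INHABITED at every CM special pair of [Deligne1971TravauxShimura] 4.18
over every `E ⊇ ∏ E*(Φᵢ)` ([Milne2005ShimuraVarieties] Def. 12.8 (60)–(61): `r(T, μ)(s) ∈ T(𝔸_f) ⊂ GSp(ψ)(𝔸_f)`; the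
NON-VACUITY theorem deferred by (σ4)-D's docstring).  `r` as a unit of `M_{2g}(𝔸_{ℚ,f})` is `⟨R(N s), R(N s⁻¹)⟩`.
[cite: Milne2005ShimuraVarieties, §6 p. 67 («GSp(ψ)») and Def. 12.8 (60)–(61) p. 114] [cite: Deligne1971TravauxShimura, 3.9 p. 140, 4.18 p. 150]
[cite: MilneCM2006, Ch. I §1 Rem. 1.24 (b) (10), Rem. 1.25] -/
theorem exists_gspFinAdelic_coe_eq_cmRecipMatrix (hE : ∀ i, traceField (Φ i) ≤ E)
    (s : (FiniteAdeleRing (𝓞 ↥E) ↥E)ˣ) :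
    ∃ r : gspFinAdelic δ,
      ((r : GL (Fin g ⊕ Fin g) finAdeleQ) : Matrix (Fin g ⊕ Fin g) (Fin g ⊕ Fin g) finAdeleQ) = c.cmRecipMatrix Φ E s ∧
        IsMultiplier (typeFormOver δ finAdeleQ) (r : GL (Fin g ⊕ Fin g) finAdeleQ) (isUnit_norm_symm E s).unit := by
  let u : GL (Fin g ⊕ Fin g) finAdeleQ :=
    ⟨c.cmRecipMatrix Φ E s, c.cmRecipMatrix Φ E s⁻¹, c.cmRecipMatrix_mul_cmRecipMatrix_inv Φ E s,
      c.cmRecipMatrix_inv_mul_cmRecipMatrix Φ E s⟩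
  have hu : IsMultiplier (typeFormOver δ finAdeleQ) u (isUnit_norm_symm E s).unit := by
    rw [isMultiplier_iff, IsUnit.unit_spec]
    exact c.transpose_cmRecipMatrix_mul_typeFormOver_mul_cmRecipMatrix Φ E hE s
  exact ⟨⟨u, _, hu⟩, rfl, hu⟩

/-- **Corollary (the shape consumed by `IsCanonical`): `∃ r : gspFinAdelic δ, (r : matrix) = c.cmRecipMatrix Φ E s`.**
[cite: Milne2005ShimuraVarieties, Def. 12.8 (60)–(62) p. 114] [cite: Deligne1971TravauxShimura, 4.18 p. 150] -/
theorem exists_gspFinAdelic_coe_eq_cmRecipMatrix' (hE : ∀ i, traceField (Φ i) ≤ E)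
    (s : (FiniteAdeleRing (𝓞 ↥E) ↥E)ˣ) :
    ∃ r : gspFinAdelic δ,
      ((r : GL (Fin g ⊕ Fin g) finAdeleQ) : Matrix (Fin g ⊕ Fin g) (Fin g ⊕ Fin g) finAdeleQ) =
        c.cmRecipMatrix Φ E s := by
  obtain ⟨r, hr, -⟩ := c.exists_gspFinAdelic_coe_eq_cmRecipMatrix Φ E hE s
  exact ⟨r, hr⟩

/-- **`r(1) = 1`**: the reciprocity element of the trivial idèle is the identity (`N_{E,Φᵢ}` and `cmRepMatrix` are unital).
[cite: Milne2005ShimuraVarieties, Def. 12.8 (60) p. 114] -/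
theorem cmRecipMatrix_one : c.cmRecipMatrix Φ E 1 = 1 := by
  unfold cmRecipMatrix
  have h : (fun i => ((reflexNormFiniteIdele (K i) (Φ i) E 1 : (FiniteAdeleRing (𝓞 (K i)) (K i))ˣ) :
      FiniteAdeleRing (𝓞 (K i)) (K i))) = 1 := by
    funext i
    rw [map_one, Units.val_one, Pi.one_apply]
  rw [h, cmRepMatrix_one]

/-- **`r(s s′) = r(s) r(s′)`**: `s ↦ c.cmRecipMatrix Φ E s` is MULTIPLICATIVE (the reflex norms are homomorphisms and
`cmRepMatrix` is multiplicative, §1) — so the reciprocity law (62) at `σ`, `σ′` composes to the law at `σσ′`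
(`art` is a homomorphism). [cite: Milne2005ShimuraVarieties, Def. 12.8 (60)–(62) p. 114] [cite: Deligne1971TravauxShimura, 3.9 p. 140] -/
theorem cmRecipMatrix_mul (s s' : (FiniteAdeleRing (𝓞 ↥E) ↥E)ˣ) :
    c.cmRecipMatrix Φ E (s * s') = c.cmRecipMatrix Φ E s * c.cmRecipMatrix Φ E s' := by
  unfold cmRecipMatrix
  rw [← cmRepMatrix_mul]
  congr 1
  funext i
  rw [Pi.mul_apply, map_mul, Units.val_mul]

end Recip

end CMStructure

end Literature.AlgebraicGeometry.ModuliOfAbelianVarieties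

end
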